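import Literature.Analysis.FluidPDE.Chen2020DissipativeGCLM
import HarnessLib

/-!
# The 1-D Hou–Luo model on the line: asymptotically self-similar blow-up from smooth data
# (Chen–Hou–Huang 2022, Thm 1) and exact self-similar blow-up with smooth profiles
# (Huang–Qin–Wang–Wei 2025, Thm 1.1) — the model, its profile system, two named facts

HONEST FRAMING (cell ns-blowup GROUP B «PROFILE SEARCH», zone Z3-b′ = the Hou–Luo boundary model put through
the cell's sheet machinery; human rulings D-0035/D-0074): **1-D MODEL (Hou–Luo), not Euler/NS.** The HL model
is a model of the 3D axisymmetric Euler equations AT THE BOUNDARY `r = 1` of a cylinder (`u = u^z`,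
`ω = ω^φ`, `θ = (u^φ)²`; Luo–Hou 2014); nothing in this file is a statement about Euler or Navier–Stokes.

Analysis/FluidPDE statements file (TWO NAMED FACTS with cite tags, one per source; definitions with bodies;
small API proved). Sources: J. Chen, T. Y. Hou, D. Huang, *Asymptotically self-similar blowup of the Hou–Luo
model for the 3D Euler equations*, Ann. PDE **8** (2022) 24 = arXiv:2106.05422 [ChenHouHuang2022HouLuo];
D. Huang, X. Qin, X. Wang, D. Wei, *Exact self-similar finite-time blowup of the Hou–Luo model with smooth
profiles*, Comm. Math. Phys. **406** (2025) = arXiv:2308.01528 [HuangQinWangWei2025HouLuo]. The model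
(CHH (1.1) = HQWW (1.1)):

  `ω_t + u ω_x = θ_x`,  `θ_t + u θ_x = 0`,  `u_x = H(ω)`,  `u(0) = 0`  on `ℝ × [0,T)`,          (HL)

`H` the Hilbert transform on the line (`lineHilbert`, convention `Hω(0) = −(1/π)∫ ω/x` = CHH §2.2 "`Hg(0) =
−(1/π)∫ g x⁻¹ dx`"), `u = ∫₀ˣ Hω` (`lineVelocity`; HQWW (1.1) carries "`u(0) = 0`" explicitly: "The normalization
condition `u(0) = 0` is not essential; we impose it throughout the paper to remove the degree of freedom due to
translation"). The exactly self-similar ansatz (HQWW (1.4)) `ω = (T−t)^{c_ω}Ω(x/(T−t)^{c_l})`,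
`θ = (T−t)^{c_θ}Θ(x/(T−t)^{c_l})` forces `c_ω = −1`, `c_θ = c_l + 2c_ω` and the PROFILE SYSTEM (HQWW §2,
(2.1) with `v = Θ_x`; = the steady states of CHH's dynamic-rescaling system (2.2) with `c_θ = c_l + 2c_ω`)

  `(c_l x + U)Ω′ = c_ω Ω + Θ′`,  `(c_l x + U)Θ′ = (c_l + 2c_ω)Θ`,  `U′ = HΩ`, `U(0) = 0`.              (PS)

* `IsHouLuoLineSolution ω θ T` — classical solutions of (HL) on `ℝ × [0,T)` (definition with body).
* `HouLuoProfileEqAt cl cω Ω Θ x` — (PS) at the point `x`.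
* `chenHouHuang2022_houLuo_blowup` — **CHH 2022, Theorem 1** (p. 3 of the arXiv text; "informal", made precise
  by their Thm 2): "There is a family of initial data `(θ₀, ω₀)` with `θ_{0,x}, ω₀ ∈ C_c^∞`, such that the
  solution of the HL model (1.1) will develop a focusing asymptotically self-similar singularity in finite time.
  The self-similar blowup profile `(θ_∞, ω_∞)` is unique within a small energy ball and its associated scaling
  exponents `c_{l,∞}, c_{ω,∞}` satisfy `|λ − 2.99870| ≤ 6·10⁻⁵` with `λ = c_{l,∞}|c_{ω,∞}|⁻¹`. Moreover, the `C^γ`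
  norm of `θ` is uniformly bounded up to the blowup time `T`, and the `C^β` norm of `θ` blows up at `T` for any
  `β ∈ (γ, 1]` with `γ = (λ−2)/λ`." (Thm 2: odd `θ_{0,x}, ω₀` with `θ₀(0) = 0`, `E(θ_{0,x} − θ̄_x, ω₀ − ω̄) ≤ E_*
  = 2.5·10⁻⁵` around the computer-assisted approximate profile `(θ̄, ω̄, c̄_l = 3, c̄_ω)`; convergence of the
  rescaled solution to an exact steady state; proof = weighted energy stability with interval-arithmetic
  verification, residual `10⁻¹⁰`.) TYPED by its printed consequence: there exist odd `ω₀ ∈ C_c^∞`, even `θ₀`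
  with `θ₀(0) = 0` and `θ_{0,x} ∈ C_c^∞`, a time `T > 0` and a classical solution of (HL) on `ℝ × [0,T)` from
  these data whose `sup|ω|` is unbounded on `[0,T)` — WEAKER than print (profile convergence, the `λ`-window and
  the Hölder statements are recorded as data/remarks, not asserted). The printed constants are the data defs
  `chh2022_lambda = 2.99870`, `chh2022_lambdaTol = 6·10⁻⁵`, `chh2022_Estar = 2.5·10⁻⁵`.
* `huangQinWangWei2025_selfSimilarHouLuo` — **HQWW 2025, Theorem 1.1** (p. 4): "The 1D Hou–Luo model (1.1) on
  the real line admits an exact self-similar finite-time blowup solution of the form (1.4) with `c_ω = −1`,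
  `c_l ∈ (2, 4.53)`, `c_θ = 2c_ω + c_l`, and a pair of profiles `Ω, Θ` that satisfy the following: (1) `Ω(x)` is
  odd in `x`, and `Θ(x)` is even in `x`. (2) The functions `f(x) = Ω(x)/x` and `m(x) = Θ′(x)/x` are both
  decreasing in `x` and convex in `x²` on `[0,+∞)`; that is, `f′(x), m′(x) < 0` and `(f′(x)/x)′, (m′(x)/x)′ ≥ 0`
  for all `x > 0`. (3) `Ω` and `Θ` are both infinitely smooth on `ℝ`. Moreover, `Ω ∈ L^∞ ∩ L^q(ℝ) ∩ Ḣ^p(ℝ)`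
  for any `q > c_l` and any `p ≥ 1`, and `Θ′ ∈ L^∞ ∩ L^q(ℝ) ∩ Ḣ^p(ℝ)` for any `q > c_l/2` and any `p ≥ 1`.
  (4) Both the limits `lim_{x→+∞} x^{1/c_l}Ω(x)` and `lim_{x→+∞} x^{2/c_l}Θ′(x)` exist and are positive and
  finite." (proof: Schauder fixed point `f = R(f)` of an explicit map, `Ω = xf`, `Θ′ = (c_l/2)x M(f)`; pure
  analysis, no computer assistance; `2 < c_l ≤ 2(k+1)/(k−1) ≈ 4.5298`, `k = 1 + √10/2`.) TYPED with the profile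
  pair solving (PS) with `c_ω = −1` at every point (the profiles are smooth on `ℝ`).
* PROVED: amplitude scaling of (PS) (HQWW (2.4) with `β = 1`: `(αΩ, α²Θ, αc_l, αc_ω)`), the exponent
  bookkeeping `c_θ = c_l − 2 ∈ (0, 2.53)` under the HQWW fact, the placement of CHH's window
  `λ ∈ [2.99864, 2.99876] ⊂ (2, 4.53)` and of the Hölder threshold `γ = (λ−2)/λ ∈ (0.3330, 0.3331)`.

## Rendering (read before citing)

* `IsHouLuoLineSolution ω θ T` (time first, `ω t x`): slices `ω t ∈ C¹ ∩ L¹`, `θ t ∈ C²` for `t ∈ [0,T)`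
  (so `u = lineVelocity (ω t)` is the classical velocity; `θ` itself need not decay — with `θ_{0,x} ∈ C_c^∞`
  it is constant near `±∞`); data attained (right-continuity of the orbits at `t = 0`); for `t ∈ (0,T)` the
  pointwise time derivatives are `−u·ω_x + θ_x` and `−u·θ_x`. CHH's solutions (transport by a locally Lipschitz
  velocity of compactly supported `ω₀`, `θ_{0,x}`) stay `C^∞` with `ω(t)`, `θ_x(t)` compactly supported up to
  `T`, hence lie in this class; the fact is an existence statement over the class, so it is implied by print.
* "focusing asymptotically self-similar singularity in finite time" ⇒ `SupNormBlowupBefore ω T` (§2.1: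
  `ω_phy(C_l(τ)x, t(τ)) = C_ω(τ)⁻¹ω(x,τ)`, `C_ω(τ) → 0`, `ω(τ) → ω_∞ ≠ 0`; `T = t(∞) < ∞`). The oddness of `ω`
  and `θ_x` and `θ(t,0) = 0` are preserved (§2.2) — recorded for the data only.
* HQWW: "`Ω ∈ Ḣ^p`, `p ≥ 1`" as `iteratedDeriv n Ω ∈ L²` for integers `n ≥ 1`; "`Θ′ ∈ Ḣ^p`, `p ≥ 1`" as
  `iteratedDeriv n Θ ∈ L²` for `n ≥ 2`; `L^q` for real `q` via `MemLp _ (ENNReal.ofReal q)`; the decreasing /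
  convex-in-`x²` clause in its printed derivative form with `deriv`.

## What is deliberately NOT here

No proofs of the two facts. NOT typed: CHH Thm 2 in its own terms (the energy `E`, the approximate profile
`(θ̄, ω̄)` — a computer-held object —, the convergence (b), the Hölder statements (c)–(d)), CHH Thm 3 / §7
(`C^{1,α}` connection to Boussinesq), the uniqueness of the profile in the energy ball; HQWW's fixed-point
machinery (§§2–4), the `β`-scaling (needs dilation covariance of `H`), the relations (2.6)
`c_l = 2v′(0)/ω′(0)`, `c_ω = c_l/2 + u′(0)`; Choi–Hou–Kiselev–Luo–Šverák–Yao 2017 (Lyapunov blow-up of the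
periodic HL model) and the Luo–Hou numerics. Whether CHH's profile and HQWW's coincide is OPEN in print (HQWW §1:
"we cannot conclude that the self-similar profiles we find are the same as the one [of CHH]"). Nothing here is
about Euler or Navier–Stokes regularity.

## References

* J. Chen, T. Y. Hou, D. Huang, Ann. PDE 8 (2022) 24, doi:10.1007/s40818-022-00140-7 = arXiv:2106.05422: (1.1),
  Thm 1 (p. 3), §2.1 (2.1)–(2.3), Thm 2 (pp. 6–7), `E_* = 2.5·10⁻⁵` (held text `paper:arxiv-2106.05422`,
  chunks 3, 6, 7, 24). [ChenHouHuang2022HouLuo]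
* D. Huang, X. Qin, X. Wang, D. Wei, Comm. Math. Phys. 406 (2025), doi:10.1007/s00220-025-05429-9 =
  arXiv:2308.01528: (1.1), (1.4), Thm 1.1 (p. 4), §2 (2.1)–(2.6) (held text `paper:arxiv-2308.01528`, chunks
  3, 4, 6). [HuangQinWangWei2025HouLuo]
* J. Chen, Nonlinearity 33 (2020) 2502 (tree `Chen2020DissipativeGCLM.lean`: `lineHilbert`, `lineVelocity`,
  `SupNormBlowupBefore`). [Chen2020DissipativeGCLM]
-/

noncomputable section

open _root_.MeasureTheory Set Filter
open scoped Real Topology ENNReal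

namespace Literature.Analysis.FluidPDE

/-! ### The Hou–Luo model on the line and its self-similar profile system -/

/-- A CLASSICAL SOLUTION of the 1-D Hou–Luo model on `ℝ × [0, T)` [cite: ChenHouHuang2022HouLuo, eq. (1.1)]
(= [cite: HuangQinWangWei2025HouLuo, eq. (1.1)]): `ω_t + u ω_x = θ_x`, `θ_t + u θ_x = 0`, `u_x = Hω`,
`u(0,t) = 0`, time first (`ω t x`, `θ t x`): (i) for `t ∈ [0,T)` the slice `ω t` is `C¹` and integrable and
`θ t` is `C²` (so `u = lineVelocity (ω t)` is the classical velocity); (ii) the orbits `t ↦ ω t x`,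
`t ↦ θ t x` are continuous within `[0,∞)` at `0` (data attained); (iii) for `t ∈ (0,T)` and every `x` the
time derivatives exist and equal `−u·ω_x + θ_x` and `−u·θ_x` at `(t, x)`. -/
def IsHouLuoLineSolution (ω θ : ℝ → ℝ → ℝ) (T : ℝ) : Prop :=
  (∀ t ∈ Ico 0 T, ContDiff ℝ 1 (ω t) ∧ Integrable (ω t) ∧ ContDiff ℝ 2 (θ t)) ∧
  (∀ x : ℝ, ContinuousWithinAt (fun t => ω t x) (Ici 0) 0 ∧
    ContinuousWithinAt (fun t => θ t x) (Ici 0) 0) ∧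
  ∀ t ∈ Ioo 0 T, ∀ x : ℝ,
    HasDerivAt (fun s => ω s x) (-(lineVelocity (ω t) x * deriv (ω t) x) + deriv (θ t) x) t ∧
    HasDerivAt (fun s => θ s x) (-(lineVelocity (ω t) x * deriv (θ t) x)) t

/-- The SELF-SIMILAR PROFILE SYSTEM (PS) of the Hou–Luo model at the point `x`
[cite: HuangQinWangWei2025HouLuo, §2 eq. (2.1)] (the steady states of the dynamic-rescaling system
[cite: ChenHouHuang2022HouLuo, eq. (2.2)] with `c_θ = c_l + 2c_ω`):
`(c_l x + U(x))·Ω′(x) = c_ω Ω(x) + Θ′(x)` and `(c_l x + U(x))·Θ′(x) = (c_l + 2c_ω)·Θ(x)`, `U = ∫₀ˣ HΩ`. -/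
def HouLuoProfileEqAt (cl cω : ℝ) (Ω Θ : ℝ → ℝ) (x : ℝ) : Prop :=
  (cl * x + lineVelocity Ω x) * deriv Ω x = cω * Ω x + deriv Θ x ∧
    (cl * x + lineVelocity Ω x) * deriv Θ x = (cl + 2 * cω) * Θ x

/-- Unfolding `HouLuoProfileEqAt`. [cite: HuangQinWangWei2025HouLuo, eq. (2.1)] -/
theorem houLuoProfileEqAt_iff (cl cω : ℝ) (Ω Θ : ℝ → ℝ) (x : ℝ) :
    HouLuoProfileEqAt cl cω Ω Θ x ↔
      (cl * x + lineVelocity Ω x) * deriv Ω x = cω * Ω x + deriv Θ x ∧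
        (cl * x + lineVelocity Ω x) * deriv Θ x = (cl + 2 * cω) * Θ x :=
  Iff.rfl

/-- The exactly self-similar ansatz of the Hou–Luo model (time first):
`ω(x,t) = (T−t)^{c_ω}Ω(x/(T−t)^{c_l})`, `θ(x,t) = (T−t)^{c_θ}Θ(x/(T−t)^{c_l})` with `c_θ = c_l + 2c_ω`.
[cite: HuangQinWangWei2025HouLuo, eq. (1.4) and §2] -/
def houLuoSelfSimilar (cω cl T : ℝ) (Ω Θ : ℝ → ℝ) : (ℝ → ℝ → ℝ) × (ℝ → ℝ → ℝ) :=
  (fun t x => (T - t) ^ cω * Ω (x / (T - t) ^ cl),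
    fun t x => (T - t) ^ (cl + 2 * cω) * Θ (x / (T - t) ^ cl))

/-- Unfolding `houLuoSelfSimilar`. [cite: HuangQinWangWei2025HouLuo, eq. (1.4)] -/
theorem houLuoSelfSimilar_def (cω cl T : ℝ) (Ω Θ : ℝ → ℝ) :
    houLuoSelfSimilar cω cl T Ω Θ =
      (fun t x => (T - t) ^ cω * Ω (x / (T - t) ^ cl),
        fun t x => (T - t) ^ (cl + 2 * cω) * Θ (x / (T - t) ^ cl)) :=
  rfl

/-- AMPLITUDE SCALING of (PS) ([cite: HuangQinWangWei2025HouLuo, eq. (2.4)] with `β = 1`): if `(Ω, Θ, c_l, c_ω)`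
solves (PS) at `x` then so does `(αΩ, α²Θ, αc_l, αc_ω)` — the first equation scales by `α²`, the second by
`α³` ("Owing to this scaling property, we can release ourselves from the restriction that `c_ω = −1`"). -/
theorem HouLuoProfileEqAt.smul {cl cω : ℝ} {Ω Θ : ℝ → ℝ} {x : ℝ} (h : HouLuoProfileEqAt cl cω Ω Θ x)
    (α : ℝ) : HouLuoProfileEqAt (α * cl) (α * cω) (fun y => α * Ω y) (fun y => α ^ 2 * Θ y) x := by
  obtain ⟨h1, h2⟩ := h
  refine ⟨?_, ?_⟩
  · rw [lineVelocity_const_mul, deriv_const_mul_field', deriv_const_mul_field']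
    have : (α * cl * x + α * lineVelocity Ω x) * (α * deriv Ω x) =
        α * α * ((cl * x + lineVelocity Ω x) * deriv Ω x) := by ring
    rw [this, h1]
    ring
  · rw [lineVelocity_const_mul, deriv_const_mul_field']
    have : (α * cl * x + α * lineVelocity Ω x) * (α ^ 2 * deriv Θ x) =
        α ^ 3 * ((cl * x + lineVelocity Ω x) * deriv Θ x) := by ring
    rw [this, h2]
    ring

/-! ### Chen–Hou–Huang 2022: blow-up from smooth data (Theorem 1) -/

/-- CHH's numerically computed self-similar exponent `λ̄ = 2.99870` of the approximate steady state
(`λ = c_{l,∞}|c_{ω,∞}|⁻¹`; the Luo–Hou 3D Euler value is `≈ 2.9215`). Printed datum.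
[cite: ChenHouHuang2022HouLuo, Thm 1] -/
def chh2022_lambda : ℝ := 2.99870

/-- CHH's rigorous tolerance: `|λ − 2.99870| ≤ 6·10⁻⁵` for the exact profile's exponent. Printed datum.
[cite: ChenHouHuang2022HouLuo, Thm 1] -/
def chh2022_lambdaTol : ℝ := 6e-5

/-- CHH's energy-ball radius `E_* = 2.5·10⁻⁵` of Theorem 2 (data within `E_*` of the approximate profile blow
up; the exact profile is unique in that ball). Printed datum. [cite: ChenHouHuang2022HouLuo, Thm 2] -/
def chh2022_Estar : ℝ := 2.5e-5

/-- CHH's Hölder threshold `γ = (λ − 2)/λ`: the `C^γ` norm of `θ` stays bounded up to `T`, every `C^β` norm with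
`β ∈ (γ, 1]` blows up. [cite: ChenHouHuang2022HouLuo, Thm 1] -/
def chh2022_holderExponent (lam : ℝ) : ℝ := (lam - 2) / lam

/-- **Chen–Hou–Huang 2022, Theorem 1** (Ann. PDE 8 (2022) 24 = arXiv:2106.05422, p. 3, verbatim in the module
docstring: a family of data with `θ_{0,x}, ω₀ ∈ C_c^∞` whose HL solution develops a focusing asymptotically
self-similar singularity in finite time, profile unique in a small energy ball, `|λ − 2.99870| ≤ 6·10⁻⁵`,
`C^γ` bounded / `C^β` blow-up; made precise by Thm 2: odd `θ_{0,x}, ω₀`, `θ₀(0) = 0`, energy-`E_*`-close to the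
approximate profile; computer-assisted stability proof.) **Statement** (the printed consequence, rendering in
the module docstring): there exist an odd `ω₀ ∈ C_c^∞(ℝ)` and an even `θ₀ ∈ C^∞(ℝ)` with `θ₀(0) = 0` and
`θ₀′ ∈ C_c^∞`, a time `T ∈ (0,∞)` and a classical solution `(ω, θ)` of (HL) on `ℝ × [0,T)` with `ω 0 = ω₀`,
`θ 0 = θ₀`, such that `sup_x |ω(t,x)|` is unbounded on `[0,T)`. WEAKER than print. Honest framing: 1-D MODEL of
the Euler boundary scenario, not Euler/NS. [cite: ChenHouHuang2022HouLuo, Thm 1 (and Thm 2(d))] -/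
def chenHouHuang2022_houLuo_blowup : Prop :=
  ∃ ω₀ θ₀ : ℝ → ℝ,
    ContDiff ℝ (⊤ : ℕ∞) ω₀ ∧ HasCompactSupport ω₀ ∧ Function.Odd ω₀ ∧
    ContDiff ℝ (⊤ : ℕ∞) θ₀ ∧ HasCompactSupport (deriv θ₀) ∧ Function.Even θ₀ ∧ θ₀ 0 = 0 ∧
    ∃ T : ℝ, 0 < T ∧ ∃ ω θ : ℝ → ℝ → ℝ,
      IsHouLuoLineSolution ω θ T ∧ ω 0 = ω₀ ∧ θ 0 = θ₀ ∧ SupNormBlowupBefore ω T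

/-- CHH's window for the exponent, `λ ∈ [2.99864, 2.99876]`, lies inside HQWW's proved range `(2, 4.53)` for
their exact profiles (arithmetic on the printed constants; whether the two profiles coincide is open in print).
[cite: ChenHouHuang2022HouLuo, Thm 1] -/
theorem chh2022_window_subset_hqww_range {lam : ℝ} (h : |lam - chh2022_lambda| ≤ chh2022_lambdaTol) :
    2 < lam ∧ lam < 4.53 := by
  unfold chh2022_lambda chh2022_lambdaTol at h
  obtain ⟨h1, h2⟩ := abs_le.1 h
  constructor <;> linarith

/-- On CHH's window the Hölder threshold `γ = (λ−2)/λ` is enclosed in `(0.3330, 0.3331)` (the "`C^{1/3}`"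
regularity of `θ` at the blow-up time, §1). [cite: ChenHouHuang2022HouLuo, Thm 1] -/
theorem chh2022_holderExponent_window {lam : ℝ} (h : |lam - chh2022_lambda| ≤ chh2022_lambdaTol) :
    chh2022_holderExponent lam ∈ Ioo (0.3330 : ℝ) 0.3331 := by
  unfold chh2022_lambda chh2022_lambdaTol at h
  obtain ⟨h1, h2⟩ := abs_le.1 h
  have hpos : 0 < lam := by linarith
  unfold chh2022_holderExponent
  constructor
  · rw [lt_div_iff₀ hpos]; linarith
  · rw [div_lt_iff₀ hpos]; linarith

/-! ### Huang–Qin–Wang–Wei 2025: exact self-similar profiles (Theorem 1.1) -/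

/-- **Huang–Qin–Wang–Wei 2025, Theorem 1.1** (Comm. Math. Phys. 406 (2025) = arXiv:2308.01528, p. 4, verbatim in
the module docstring: the HL model admits an exact self-similar blow-up `ω = (T−t)^{c_ω}Ω(x/(T−t)^{c_l})`,
`θ = (T−t)^{c_θ}Θ(x/(T−t)^{c_l})` with `c_ω = −1`, `c_l ∈ (2, 4.53)`, `c_θ = 2c_ω + c_l`; `Ω` odd, `Θ` even;
`f = Ω/x`, `m = Θ′/x` with `f′, m′ < 0` and `(f′/x)′, (m′/x)′ ≥ 0` on `x > 0`; `Ω, Θ ∈ C^∞(ℝ)`,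
`Ω ∈ L^∞ ∩ L^q ∩ Ḣ^p` (`q > c_l`, `p ≥ 1`), `Θ′ ∈ L^∞ ∩ L^q ∩ Ḣ^p` (`q > c_l/2`, `p ≥ 1`); `x^{1/c_l}Ω(x)` and
`x^{2/c_l}Θ′(x)` have positive finite limits at `+∞`; proof by a Schauder fixed point, no computer assistance.)
**Statement**: there exist smooth `Ω, Θ : ℝ → ℝ` and `c_l ∈ (2, 4.53)` with `Ω` odd, `Θ` even, solving the
profile system (PS) with `c_ω = −1` at every point, with the printed monotonicity/convexity, integrability
(integer Sobolev orders) and tail clauses. Honest framing: 1-D MODEL, not Euler/NS.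
[cite: HuangQinWangWei2025HouLuo, Thm 1.1] -/
def huangQinWangWei2025_selfSimilarHouLuo : Prop :=
  ∃ (Ω Θ : ℝ → ℝ) (cl : ℝ), 2 < cl ∧ cl < 4.53 ∧
    Function.Odd Ω ∧ Function.Even Θ ∧ ContDiff ℝ (⊤ : ℕ∞) Ω ∧ ContDiff ℝ (⊤ : ℕ∞) Θ ∧
    (∀ x : ℝ, HouLuoProfileEqAt cl (-1) Ω Θ x) ∧
    (∀ x : ℝ, 0 < x → deriv (fun y => Ω y / y) x < 0 ∧ deriv (fun y => deriv Θ y / y) x < 0) ∧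
    (∀ x : ℝ, 0 < x → 0 ≤ deriv (fun y => deriv (fun z => Ω z / z) y / y) x ∧
      0 ≤ deriv (fun y => deriv (fun z => deriv Θ z / z) y / y) x) ∧
    (∃ M : ℝ, ∀ x, |Ω x| ≤ M) ∧ (∀ q : ℝ, cl < q → MemLp Ω (ENNReal.ofReal q) volume) ∧
    (∀ n : ℕ, 1 ≤ n → MemLp (iteratedDeriv n Ω) 2 volume) ∧
    (∃ M : ℝ, ∀ x, |deriv Θ x| ≤ M) ∧ (∀ q : ℝ, cl / 2 < q → MemLp (deriv Θ) (ENNReal.ofReal q) volume) ∧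
    (∀ n : ℕ, 2 ≤ n → MemLp (iteratedDeriv n Θ) 2 volume) ∧
    (∃ C₁ : ℝ, 0 < C₁ ∧ Tendsto (fun x => x ^ (1 / cl) * Ω x) atTop (𝓝 C₁)) ∧
    (∃ C₂ : ℝ, 0 < C₂ ∧ Tendsto (fun x => x ^ (2 / cl) * deriv Θ x) atTop (𝓝 C₂))

/-- Exponent bookkeeping under the HQWW fact: the temperature exponent `c_θ = c_l + 2c_ω = c_l − 2` lies in
`(0, 2.53)` — in the exact self-similar solution `θ = (T−t)^{c_θ}Θ(x/(T−t)^{c_l})` the amplitude of `θ`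
DECAYS while `θ_x ∼ (T−t)^{c_θ − c_l} = (T−t)^{−2}` and `ω ∼ (T−t)^{−1}` blow up.
[cite: HuangQinWangWei2025HouLuo, Thm 1.1] -/
theorem huangQinWangWei2025_selfSimilarHouLuo.ctheta_window (h : huangQinWangWei2025_selfSimilarHouLuo) :
    ∃ (Ω Θ : ℝ → ℝ) (cl : ℝ), (∀ x : ℝ, HouLuoProfileEqAt cl (-1) Ω Θ x) ∧
      0 < cl + 2 * (-1) ∧ cl + 2 * (-1) < 2.53 ∧ cl + 2 * (-1) - cl = -2 := by
  obtain ⟨Ω, Θ, cl, h2, h453, -, -, -, -, heq, -⟩ := h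
  exact ⟨Ω, Θ, cl, heq, by linarith, by linarith, by ring⟩

/-- Consumer form of the HQWW fact for the cell's Z3-b′ sheet: a smooth odd/even profile pair solving (PS) with
`c_ω = −1` everywhere, `c_l ∈ (2, 4.53)`, `Ω > 0`-tail `x^{1/c_l}Ω → C₁ > 0`.
[cite: HuangQinWangWei2025HouLuo, Thm 1.1] -/
theorem huangQinWangWei2025_selfSimilarHouLuo.exists_smooth_profiles
    (h : huangQinWangWei2025_selfSimilarHouLuo) :
    ∃ (Ω Θ : ℝ → ℝ) (cl : ℝ), 2 < cl ∧ cl < 4.53 ∧ Function.Odd Ω ∧ Function.Even Θ ∧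
      ContDiff ℝ (⊤ : ℕ∞) Ω ∧ ContDiff ℝ (⊤ : ℕ∞) Θ ∧ (∀ x : ℝ, HouLuoProfileEqAt cl (-1) Ω Θ x) ∧
      ∃ C₁ : ℝ, 0 < C₁ ∧ Tendsto (fun x => x ^ (1 / cl) * Ω x) atTop (𝓝 C₁) := by
  obtain ⟨Ω, Θ, cl, h2, h453, hodd, heven, hsΩ, hsΘ, heq, -, -, -, -, -, -, -, -, hlim, -⟩ := h
  exact ⟨Ω, Θ, cl, h2, h453, hodd, heven, hsΩ, hsΘ, heq, hlim⟩

end Literature.Analysis.FluidPDE
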